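import Mathlib
import Summits.Parity.GeneralizedHardyLittlewood.Theses.LiouvilleShiftedTables
import Summits.Parity.GeneralizedHardyLittlewood.Theorems.LiouvilleShiftedTablesBVLiouville

/-!
# Stub `stub_bv` of line `helson-kronecker-inverse` (crux `TableChowla`, stmt-Parity-14270)

The registered stub `stub_bv` is BY NAME the route's support item
`Summit.Parity.GeneralizedHardyLittlewood.Theses.LiouvilleShiftedTables.BVLiouville`
(stmt-Parity-13324): Bombieri–Vinogradov for the Liouville function at level `x^{1/2-ε}` with
absolute values, one arbitrary residue `0 ≤ c_d < d` and one height `y_d ≤ x` per modulus,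

  `∑_{d ≤ x^{1/2-ε}} |∑_{n ≤ y_d/d} λ(dn + c_d)| ≤ C x/(log x)^A`   (`x ≥ x₀(ε, A)`).

That item is PROVED in the tree (unconditionally, axioms `propext`, `Classical.choice`,
`Quot.sound`) by `Summit.Parity.GeneralizedHardyLittlewood.Cruxes.TypeI2Dilated.PeelToDrappeau.BVLiouville_proof`
(`Theorems/LiouvilleShiftedTablesBVLiouville.lean`, the same item being the stub `stub_bvLiouville`
of line `peel-to-drappeau` of the sibling crux `TypeI2Dilated`): arbitrary residues reduce to
reduced ones modulo `d/(c_d, d)` by complete multiplicativity, progression sums to prefix sums, and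
the moduli grouped by `g = (c_d, d)` are fed, at scale `2x/g`, to the per-modulus-height
Bombieri–Vinogradov theorem for `λ` in reduced classes
(`Literature.NumberTheory.Sieve.BVLiouvilleHeights.bv_liouvilleAP`; an independent proof of that
input is this line's helper `bv_liouville_progression`,
`Theorems/LiouvilleShiftedTablesTableChowlaBVLiouvilleAux.lean`), itself from the tree's PROVED
Bombieri–Vinogradov theorem for `μ` (`Literature.NumberTheory.Sieve.bombieriVinogradov_moebius`)
and Siegel–Walfisz for `μ` (`Literature.NumberTheory.LFunctions.SiegelWalfiszMoebius_holds`).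
This file only records the stub under its registered name, so that the line's skeleton closes
`stub_periodic := stub_periodic_of_bv stub_bv`.

References: Iwaniec–Kowalski, *Analytic Number Theory* (2004), Thm 17.4; Fouvry–Tenenbaum,
Trans. AMS 375 (2022), Thm 1.8; Bombieri–Friedlander–Iwaniec, Acta Math. 156 (1986), Thm 0.
-/

namespace Summit.Parity.GeneralizedHardyLittlewood.Theorems.TableChowla.HelsonKroneckerInverse

/-- **STUB `stub_bv` = `BVLiouville` (stmt-Parity-13324), PROVED**: Bombieri–Vinogradov for the
Liouville function at level `x^{1/2-ε}` with one arbitrary residue `0 ≤ c_d < d` and one height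
`y_d ≤ x` per modulus — the tree's
`Summit.Parity.GeneralizedHardyLittlewood.Cruxes.TypeI2Dilated.PeelToDrappeau.BVLiouville_proof`
under the name registered by the skeleton of line `helson-kronecker-inverse`. [folklore] -/
theorem stub_bv :
    Summit.Parity.GeneralizedHardyLittlewood.Theses.LiouvilleShiftedTables.BVLiouville :=
  Summit.Parity.GeneralizedHardyLittlewood.Cruxes.TypeI2Dilated.PeelToDrappeau.BVLiouville_proof

end Summit.Parity.GeneralizedHardyLittlewood.Theorems.TableChowla.HelsonKroneckerInverse
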